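import Literature.NumberTheory.Automorphic.UnitaryGroupRankOneBigCell
import HarnessLib

/-!
# The quasi-split unitary group in TWO variables over a valued field with ANY isometric involution: the Cartan decomposition
# `U(σ, Φ₂)(K) = ⋃ₙ K₀ · d(ϖ, (σϖ)⁻¹)ⁿ · K₀ · Z(U)`

Topic `NumberTheory/Automorphic`; namespace `Literature.NumberTheory.Automorphic.UnitaryGroup.Two`.  THEOREMS ONLY (no `def`, no `instance`,
no notation, no named fact, no `sorry`; axioms ⊆ {propext, Classical.choice, Quot.sound}).  The `N = 2` twin of the rank-3 series ★
`UnitaryGroupRankOneBigCell` → ★ `UnitaryGroupRankOneIwasawa` → ★ `UnitaryGroupRankOneCartanAnyInvolution` (`exists_cartan_of_involution`), for the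
CM crux line (N-H-ii′) of `H413` (cell `pub/hodgecm-mathlib`): its head `exists_cartan_of_involution_two` is EXACTLY the hypothesis `hCartan₂` of ★
`jacquetVanishing_isSupercuspidal_two_of_cartan` (`U2JacquetVanishingSupercuspidalOfCartan`).

SETTING.  `K` a field, `σ : K →+* K` an involution (`hσσ`), `Φ₂ = antidiag(1, 1)` (`hJ : J = (StdForm.antidiagonal 2).over K`), `U = U(σ, Φ₂)(K)`;
from §2 on `Valued K ℤᵐ⁰` (+ the `ValuativeRel` bridge) and `hσv : |σ x| = |x|`, `K₀ = U ∩ GL₂(𝒪) = (glInt 2 K).comap U.subtype`, `ϖ` a uniformiser,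
`a ∈ U` with matrix `d(ϖ, (σϖ)⁻¹)`.  NO condition on the residue characteristic, NO `σ`-fixed uniformiser (ramified `K ∕ K^σ` included).
* §1 (algebra) the four unitarity relations `sum_rel_of_mem`, `inv_apply_of_mem` (`(g⁻¹)_{ij} = σ g_{1-j,1-i}`), the constructors `exists_coe_eq`
  (any matrix satisfying the relations), `exists_coe_eq_lower` (`ū(y)`, `y + σy = 0`), `exists_coe_eq_weyl_mul_lower` (`w₀ ū(y)`), `exists_coe_eq_diag`
  (`d(p, s)`, `σp·s = 1`), `exists_coe_eq_weyl` (`w₀`), `exists_coe_eq_scalar_mem_center` (`ε·1`, `σε·ε = 1`).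
* §2 (valuation) `mem_glInt_iff_forall_v_le_one` (`K₀` by entries), ROW REDUCTION `exists_glInt_mul_upper` (`g = k b`, `b` upper triangular:
  `k = ū(c∕a)` if `|c| ≤ |a|`, `k = w₀ ū(a∕c)` otherwise), `exists_glInt_mul_diag_mul_glInt_of_upper` (`b = k₁ t k₂`, `t` diagonal: divide by the
  dominant entry; when the corner `q` dominates, `ū(s∕q) · b · w₀` is upper triangular with dominant diagonal).
* §3 (the ray) `coe_pow_eq_diagonal_two` (`aⁿ = d(ϖⁿ, (σϖ)⁻ⁿ)`), `exists_eq_glInt_mul_pow` (`|t₀₀| = |ϖ|ⁿ ⇒ t ∈ K₀ aⁿ`), `inv_pow_eq`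
  (`a⁻ⁿ = w₀ aⁿ w₀ · (σϖ∕ϖ)ⁿ·1`), `exists_diag_eq_pow` (`T ⊂ K₀ a^ℕ K₀ Z(U)`), and the head **`exists_cartan_of_involution_two`**.

HONEST LABEL: pure structure theory; HC_CM is proved only modulo the printed citations (hLiu418, h413) until rung 0 closes.

## References
* [BruhatTits1972] F. Bruhat, J. Tits, *Groupes réductifs sur un corps local I*, Publ. Math. IHÉS 41 (1972), (4.4.3).
* [Tits1979] J. Tits, *Reductive groups over local fields*, Proc. Sympos. Pure Math. 33.1 (1979), §3.3.2–§3.3.3.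
* [Rogawski1990] J. D. Rogawski, Ann. of Math. Stud. 123 (1990), §1.9–§1.10.
* [PlatonovRapinchuk1994] V. Platonov, A. Rapinchuk, *Algebraic Groups and Number Theory* (1994), §3.3.
* [Serre1979] J.-P. Serre, *Local Fields*, GTM 67 (1979), Ch. II §1.
-/

set_option autoImplicit false

open scoped MatrixGroups Pointwise Topology WithZero
open ValuativeRel Matrix

namespace Literature.NumberTheory.Automorphic

namespace UnitaryGroup

namespace Two

/-! ## §1 Algebra of `U(σ, Φ₂)(K)`: relations, inverse, constructors -/

section Algebra

variable {K : Type*} [Field K] (σ : K →+* K) {J : Matrix (Fin 2) (Fin 2) K} (hJ : J = (StdForm.antidiagonal 2).over K)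

/-- `Φ₂ = antidiag(1, 1)` as an explicit matrix. [cite: Rogawski1990, §1.9 p. 8] -/
theorem antidiagonal_two_over_eq : (StdForm.antidiagonal 2).over K = !![(0 : K), 1; 1, 0] := by
  ext i j
  fin_cases i <;> fin_cases j <;> simp [StdForm.over, StdForm.antidiagonal_J_apply, Fin.rev]

include hJ in
/-- **The four unitarity relations** `∑ᵢ σ(g_{ia}) g_{1-i, b} = δ_{b, 1-a}` of `g ∈ U(σ, Φ₂)`. [cite: Rogawski1990, §1.9 p. 8] -/
theorem sum_rel_of_mem (g : ↥(unitaryGroupOfForm σ J)) (a b : Fin 2) :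
    ∑ i, σ (((g : GL (Fin 2) K) : Matrix (Fin 2) (Fin 2) K) i a) * ((g : GL (Fin 2) K) : Matrix (Fin 2) (Fin 2) K) (Fin.rev i) b =
      if b = Fin.rev a then 1 else 0 := by
  have hgU : ((g : ↥(unitaryGroupOfForm σ J)) : GL (Fin 2) K) ∈ unitaryGroupOfForm σ ((StdForm.antidiagonal 2).over K) := by
    rw [← hJ]; exact g.2
  exact (mem_unitaryGroupOfForm_antidiagonal_iff_sum' σ 2 _).1 hgU a b

include hJ in
/-- The relation at `(0, 0)`: `σ(g₀₀) g₁₀ + σ(g₁₀) g₀₀ = 0`. [cite: Rogawski1990, §1.9 p. 8] -/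
theorem rel00 (g : ↥(unitaryGroupOfForm σ J)) :
    σ (((g : GL (Fin 2) K) : Matrix (Fin 2) (Fin 2) K) 0 0) * ((g : GL (Fin 2) K) : Matrix (Fin 2) (Fin 2) K) 1 0 +
      σ (((g : GL (Fin 2) K) : Matrix (Fin 2) (Fin 2) K) 1 0) * ((g : GL (Fin 2) K) : Matrix (Fin 2) (Fin 2) K) 0 0 = 0 := by
  have h := sum_rel_of_mem σ hJ g 0 0
  rw [Fin.sum_univ_two] at h
  simpa using h

include hJ in
/-- The relation at `(0, 1)`: `σ(g₀₀) g₁₁ + σ(g₁₀) g₀₁ = 1`. [cite: Rogawski1990, §1.9 p. 8] -/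
theorem rel01 (g : ↥(unitaryGroupOfForm σ J)) :
    σ (((g : GL (Fin 2) K) : Matrix (Fin 2) (Fin 2) K) 0 0) * ((g : GL (Fin 2) K) : Matrix (Fin 2) (Fin 2) K) 1 1 +
      σ (((g : GL (Fin 2) K) : Matrix (Fin 2) (Fin 2) K) 1 0) * ((g : GL (Fin 2) K) : Matrix (Fin 2) (Fin 2) K) 0 1 = 1 := by
  have h := sum_rel_of_mem σ hJ g 0 1
  rw [Fin.sum_univ_two] at h
  simpa using h

include hJ in
/-- The relation at `(1, 0)`: `σ(g₀₁) g₁₀ + σ(g₁₁) g₀₀ = 1`. [cite: Rogawski1990, §1.9 p. 8] -/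
theorem rel10 (g : ↥(unitaryGroupOfForm σ J)) :
    σ (((g : GL (Fin 2) K) : Matrix (Fin 2) (Fin 2) K) 0 1) * ((g : GL (Fin 2) K) : Matrix (Fin 2) (Fin 2) K) 1 0 +
      σ (((g : GL (Fin 2) K) : Matrix (Fin 2) (Fin 2) K) 1 1) * ((g : GL (Fin 2) K) : Matrix (Fin 2) (Fin 2) K) 0 0 = 1 := by
  have h := sum_rel_of_mem σ hJ g 1 0
  rw [Fin.sum_univ_two] at h
  simpa using h

include hJ in
/-- The relation at `(1, 1)`: `σ(g₀₁) g₁₁ + σ(g₁₁) g₀₁ = 0`. [cite: Rogawski1990, §1.9 p. 8] -/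
theorem rel11 (g : ↥(unitaryGroupOfForm σ J)) :
    σ (((g : GL (Fin 2) K) : Matrix (Fin 2) (Fin 2) K) 0 1) * ((g : GL (Fin 2) K) : Matrix (Fin 2) (Fin 2) K) 1 1 +
      σ (((g : GL (Fin 2) K) : Matrix (Fin 2) (Fin 2) K) 1 1) * ((g : GL (Fin 2) K) : Matrix (Fin 2) (Fin 2) K) 0 1 = 0 := by
  have h := sum_rel_of_mem σ hJ g 1 1
  rw [Fin.sum_univ_two] at h
  simpa using h

include hJ in
/-- **The inverse of a unitary matrix, entrywise**: `(g⁻¹)_{ij} = σ(g_{1-j, 1-i})` (`g⁻¹ = Φ₂ ᵗ(σg) Φ₂`). [cite: Rogawski1990, §1.9 p. 8] -/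
theorem inv_apply_of_mem (g : ↥(unitaryGroupOfForm σ J)) (i j : Fin 2) :
    (((g : GL (Fin 2) K)⁻¹ : GL (Fin 2) K) : Matrix (Fin 2) (Fin 2) K) i j =
      σ ((((g : GL (Fin 2) K) : Matrix (Fin 2) (Fin 2) K)) (Fin.rev j) (Fin.rev i)) := by
  have key : (Matrix.of fun i j => σ ((((g : GL (Fin 2) K) : Matrix (Fin 2) (Fin 2) K)) (Fin.rev j) (Fin.rev i))) *
      ((g : GL (Fin 2) K) : Matrix (Fin 2) (Fin 2) K) = 1 := by
    ext a b
    rw [Matrix.mul_apply, ← Equiv.sum_comp Fin.revPerm]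
    simp only [Matrix.of_apply, Fin.revPerm_apply, Fin.rev_rev]
    rw [sum_rel_of_mem σ hJ g (Fin.rev a) b, Fin.rev_rev, Matrix.one_apply]
    by_cases hab : a = b
    · rw [if_pos hab, if_pos hab.symm]
    · rw [if_neg hab, if_neg (Ne.symm hab)]
  rw [Matrix.coe_units_inv, Matrix.inv_eq_left_inv key, Matrix.of_apply]

include hJ in
/-- **Constructor**: a `2 × 2` matrix `M` with `det M ≠ 0` satisfying the four unitarity relations is the matrix of an element of `U(σ, Φ₂)`.
[cite: Rogawski1990, §1.9 p. 8] -/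
theorem exists_coe_eq (M : Matrix (Fin 2) (Fin 2) K) (hdet : M.det ≠ 0)
    (hrel : ∀ a b : Fin 2, ∑ i, σ (M i a) * M (Fin.rev i) b = if b = Fin.rev a then 1 else 0) :
    ∃ k : ↥(unitaryGroupOfForm σ J), ((k : GL (Fin 2) K) : Matrix (Fin 2) (Fin 2) K) = M := by
  have hmem : Matrix.GeneralLinearGroup.mkOfDetNeZero _ hdet ∈ unitaryGroupOfForm σ J := by
    rw [hJ, mem_unitaryGroupOfForm_antidiagonal_iff_sum']
    intro a b
    rw [Matrix.GeneralLinearGroup.val_mkOfDetNeZero]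
    exact hrel a b
  exact ⟨⟨_, hmem⟩, Matrix.GeneralLinearGroup.val_mkOfDetNeZero _ _⟩

include hJ in
/-- **Lower unitriangular unitary elements** `ū(y) = !![1, 0; y, 1] ∈ U(σ, Φ₂)` for `y + σ y = 0`. [cite: Rogawski1990, §1.10 p. 9] -/
theorem exists_coe_eq_lower {y : K} (hy : y + σ y = 0) :
    ∃ k : ↥(unitaryGroupOfForm σ J), ((k : GL (Fin 2) K) : Matrix (Fin 2) (Fin 2) K) = !![1, 0; y, 1] := by
  refine exists_coe_eq σ hJ _ (by rw [Matrix.det_fin_two]; simp) fun a b => ?_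
  fin_cases a <;> fin_cases b <;> simp [Fin.sum_univ_two]
  · linear_combination hy

include hJ in
/-- The element `w₀ ū(y) = !![y, 1; 1, 0] ∈ U(σ, Φ₂)` for `y + σ y = 0`. [cite: Rogawski1990, §1.10 p. 9] -/
theorem exists_coe_eq_weyl_mul_lower {y : K} (hy : y + σ y = 0) :
    ∃ k : ↥(unitaryGroupOfForm σ J), ((k : GL (Fin 2) K) : Matrix (Fin 2) (Fin 2) K) = !![y, 1; 1, 0] := by
  refine exists_coe_eq σ hJ _ (by rw [Matrix.det_fin_two]; simp) fun a b => ?_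
  fin_cases a <;> fin_cases b <;> simp [Fin.sum_univ_two]
  · linear_combination hy

include hJ in
/-- **Diagonal unitary elements** `d(p, s) ∈ U(σ, Φ₂)` for `σ p · s = 1` (`σ` an involution; then also `σ s · p = 1`).
[cite: Rogawski1990, §1.10 p. 9] -/
theorem exists_coe_eq_diag (hσσ : ∀ x, σ (σ x) = x) {p s : K} (hps : σ p * s = 1) :
    ∃ t : ↥(unitaryGroupOfForm σ J), ((t : GL (Fin 2) K) : Matrix (Fin 2) (Fin 2) K) = !![p, 0; 0, s] := by
  have hsp : σ s * p = 1 := by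
    have h := congrArg σ hps
    rw [map_mul, hσσ, map_one, mul_comm] at h
    exact h
  have hp : p ≠ 0 := fun h => by rw [h, mul_zero] at hsp; exact zero_ne_one hsp
  have hs : s ≠ 0 := fun h => by rw [h, mul_zero] at hps; exact zero_ne_one hps
  refine exists_coe_eq σ hJ _ (by rw [Matrix.det_fin_two]; simp [hp, hs]) fun a b => ?_
  fin_cases a <;> fin_cases b <;> simp [Fin.sum_univ_two, hps, hsp]

include hJ in
/-- The Weyl element `w₀ = !![0, 1; 1, 0] ∈ U(σ, Φ₂)`. [cite: Rogawski1990, §1.10 p. 9] -/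
theorem exists_coe_eq_weyl :
    ∃ w : ↥(unitaryGroupOfForm σ J), ((w : GL (Fin 2) K) : Matrix (Fin 2) (Fin 2) K) = !![0, 1; 1, 0] := by
  refine exists_coe_eq σ hJ _ (by rw [Matrix.det_fin_two]; simp) fun a b => ?_
  fin_cases a <;> fin_cases b <;> simp [Fin.sum_univ_two]

include hJ in
/-- **Central unitary scalars**: `ε · 1 ∈ Z(U(σ, Φ₂))` for `σ ε · ε = 1`. [cite: Rogawski1990, §1.10 p. 9] -/
theorem exists_coe_eq_scalar_mem_center (hσσ : ∀ x, σ (σ x) = x) {ε : K} (hε : σ ε * ε = 1) :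
    ∃ z : ↥(unitaryGroupOfForm σ J), z ∈ Subgroup.center ↥(unitaryGroupOfForm σ J) ∧
      ((z : GL (Fin 2) K) : Matrix (Fin 2) (Fin 2) K) = !![ε, 0; 0, ε] := by
  obtain ⟨z, hz⟩ := exists_coe_eq_diag σ hJ hσσ hε
  refine ⟨z, ?_, hz⟩
  rw [Subgroup.mem_center_iff]
  intro g
  have hsc : ((z : GL (Fin 2) K) : Matrix (Fin 2) (Fin 2) K) = ε • (1 : Matrix (Fin 2) (Fin 2) K) := by
    rw [hz]; ext i j; fin_cases i <;> fin_cases j <;> simp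
  apply Subtype.ext
  apply Units.ext
  change ((g : GL (Fin 2) K) : Matrix (Fin 2) (Fin 2) K) * ((z : GL (Fin 2) K) : Matrix (Fin 2) (Fin 2) K) =
    ((z : GL (Fin 2) K) : Matrix (Fin 2) (Fin 2) K) * ((g : GL (Fin 2) K) : Matrix (Fin 2) (Fin 2) K)
  rw [hsc, Matrix.mul_smul, Matrix.smul_mul, Matrix.mul_one, Matrix.one_mul]

/-- Matrix of a product in `U`, entrywise (`2 × 2`). [folklore] -/
private theorem coe_mul_apply (g h : ↥(unitaryGroupOfForm σ J)) (i j : Fin 2) :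
    (((g * h : ↥(unitaryGroupOfForm σ J)) : GL (Fin 2) K) : Matrix (Fin 2) (Fin 2) K) i j =
      ((g : GL (Fin 2) K) : Matrix (Fin 2) (Fin 2) K) i 0 * ((h : GL (Fin 2) K) : Matrix (Fin 2) (Fin 2) K) 0 j +
        ((g : GL (Fin 2) K) : Matrix (Fin 2) (Fin 2) K) i 1 * ((h : GL (Fin 2) K) : Matrix (Fin 2) (Fin 2) K) 1 j := by
  rw [Subgroup.coe_mul, Units.val_mul, Matrix.mul_apply, Fin.sum_univ_two]

end Algebra

/-! ## §2 `K₀` by entries; row reduction `U = K₀ · B`; `B ⊂ K₀ T K₀` -/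

section Valuation

variable {K : Type*} [Field K] [Valued K ℤᵐ⁰] [ValuativeRel K] [(Valued.v : Valuation K ℤᵐ⁰).Compatible]
  (σ : K →+* K) {J : Matrix (Fin 2) (Fin 2) K} (hJ : J = (StdForm.antidiagonal 2).over K)

include hJ in
/-- **`K₀ = U ∩ GL₂(𝒪)` is cut out by the entries alone** (`σ` isometric): `g ∈ GL₂(𝒪)` iff every entry of `g` is integral (the inverse is
`Φ₂ ᵗ(σg) Φ₂`). [cite: PlatonovRapinchuk1994, §3.3] -/
theorem mem_glInt_iff_forall_v_le_one (hσv : ∀ x, Valued.v (σ x) = Valued.v x) (g : ↥(unitaryGroupOfForm σ J)) :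
    (g : GL (Fin 2) K) ∈ glInt 2 K ↔ ∀ i j, Valued.v (((g : GL (Fin 2) K) : Matrix (Fin 2) (Fin 2) K) i j) ≤ 1 := by
  constructor
  · intro h i j
    exact (v_le_one_iff_valuation_le_one _).2 ((Valuation.mem_integer_iff _ _).1 (((mem_glInt_iff _).1 h).1 i j))
  · intro h
    refine mem_glInt_of_forall_valuation_le_one (fun i j => (v_le_one_iff_valuation_le_one _).1 (h i j)) fun i j => ?_
    refine (v_le_one_iff_valuation_le_one _).1 ?_
    rw [inv_apply_of_mem σ hJ g i j, hσv]
    exact h _ _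

include hJ in
/-- Matrix form: a unitary `k` with matrix `M`, `|M_{ij}| ≤ 1`, lies in `K₀`. [cite: PlatonovRapinchuk1994, §3.3] -/
theorem mem_glInt_of_coe_eq (hσv : ∀ x, Valued.v (σ x) = Valued.v x) {k : ↥(unitaryGroupOfForm σ J)} {M : Matrix (Fin 2) (Fin 2) K}
    (hk : ((k : GL (Fin 2) K) : Matrix (Fin 2) (Fin 2) K) = M) (hM : ∀ i j, Valued.v (M i j) ≤ 1) :
    k ∈ (glInt 2 K).comap (unitaryGroupOfForm σ J).subtype := by
  rw [Subgroup.mem_comap, Subgroup.coe_subtype, mem_glInt_iff_forall_v_le_one σ hJ hσv]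
  intro i j
  rw [hk]
  exact hM i j

omit [Valued K ℤᵐ⁰] [ValuativeRel K] [(Valued.v : Valuation K ℤᵐ⁰).Compatible] in
/-- `σ`-skewness passes to quotients: `σa·c + σc·a = 0`, `a ≠ 0` ⇒ `c∕a + σ(c∕a) = 0`. [folklore] -/
private theorem div_add_map_div_eq_zero {a c : K} (ha : a ≠ 0) (h : σ a * c + σ c * a = 0) : c / a + σ (c / a) = 0 := by
  have hσa : σ a ≠ 0 := (map_ne_zero σ).2 ha
  rw [map_div₀, div_add_div _ _ ha hσa, div_eq_zero_iff]
  left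
  linear_combination h

include hJ in
/-- **ROW REDUCTION (Iwasawa `U = K₀ · B`)**: every `g ∈ U(σ, Φ₂)` is `k · b` with `k ∈ K₀` and `b` upper triangular — `k = ū(c∕a)` when
`|c| ≤ |a|` and `k = w₀ ū(a∕c)` when `|a| < |c|` (`a = g₀₀`, `c = g₁₀`; `c∕a`, `a∕c` are `σ`-skew by the relation at `(0,0)`).
[cite: BruhatTits1972, (4.4.3)] [cite: Tits1979, §3.3.2] -/
theorem exists_glInt_mul_upper (hσv : ∀ x, Valued.v (σ x) = Valued.v x) (g : ↥(unitaryGroupOfForm σ J)) :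
    ∃ k ∈ (glInt 2 K).comap (unitaryGroupOfForm σ J).subtype, ∃ b : ↥(unitaryGroupOfForm σ J),
      g = k * b ∧ ((b : GL (Fin 2) K) : Matrix (Fin 2) (Fin 2) K) 1 0 = 0 := by
  have hrel := rel00 σ hJ g
  have hne : ((g : GL (Fin 2) K) : Matrix (Fin 2) (Fin 2) K) 0 0 ≠ 0 ∨ ((g : GL (Fin 2) K) : Matrix (Fin 2) (Fin 2) K) 1 0 ≠ 0 := by
    by_contra h
    push Not at h
    have hdet : ((g : GL (Fin 2) K) : Matrix (Fin 2) (Fin 2) K).det = 0 := by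
      rw [Matrix.det_fin_two, h.1, h.2]; ring
    have hdet0 : ((g : GL (Fin 2) K) : Matrix (Fin 2) (Fin 2) K).det ≠ 0 := by
      rw [← Matrix.GeneralLinearGroup.val_det_apply]; exact Units.ne_zero _
    exact hdet0 hdet
  rcases le_or_gt (Valued.v (((g : GL (Fin 2) K) : Matrix (Fin 2) (Fin 2) K) 1 0)) (Valued.v (((g : GL (Fin 2) K) : Matrix (Fin 2) (Fin 2) K) 0 0)) with hle | hlt
  · -- `|c| ≤ |a|`: `k = ū(c/a)`
    have ha : ((g : GL (Fin 2) K) : Matrix (Fin 2) (Fin 2) K) 0 0 ≠ 0 := by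
      rcases hne with h | h
      · exact h
      · intro h0; rw [h0, Valuation.map_zero, le_zero_iff, Valuation.zero_iff] at hle; exact h hle
    have hy := div_add_map_div_eq_zero σ ha hrel
    obtain ⟨k, hk⟩ := exists_coe_eq_lower σ hJ hy
    have hv : Valued.v (((g : GL (Fin 2) K) : Matrix (Fin 2) (Fin 2) K) 1 0) / Valued.v (((g : GL (Fin 2) K) : Matrix (Fin 2) (Fin 2) K) 0 0) ≤ 1 := div_le_one_of_le₀ hle zero_le
    refine ⟨k, mem_glInt_of_coe_eq σ hJ hσv hk fun i j => ?_, k⁻¹ * g, by group, ?_⟩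
    · fin_cases i <;> fin_cases j <;> simp [hv]
    · rw [coe_mul_apply, Subgroup.coe_inv, inv_apply_of_mem σ hJ k, inv_apply_of_mem σ hJ k, hk]
      simp only [show Fin.rev (0 : Fin 2) = 1 from rfl, show Fin.rev (1 : Fin 2) = 0 from rfl]
      simp [map_div₀]
      have hσa : σ (((g : GL (Fin 2) K) : Matrix (Fin 2) (Fin 2) K) 0 0) ≠ 0 := (map_ne_zero σ).2 ha
      field_simp
      linear_combination hrel
  · -- `|a| < |c|`: `k = w₀ ū(a/c)`
    have hc : ((g : GL (Fin 2) K) : Matrix (Fin 2) (Fin 2) K) 1 0 ≠ 0 := by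
      intro h0; rw [h0, Valuation.map_zero] at hlt; exact not_lt_zero hlt
    have hrel' : σ (((g : GL (Fin 2) K) : Matrix (Fin 2) (Fin 2) K) 1 0) * ((g : GL (Fin 2) K) : Matrix (Fin 2) (Fin 2) K) 0 0 +
        σ (((g : GL (Fin 2) K) : Matrix (Fin 2) (Fin 2) K) 0 0) * ((g : GL (Fin 2) K) : Matrix (Fin 2) (Fin 2) K) 1 0 = 0 := by
      linear_combination hrel
    have hy := div_add_map_div_eq_zero σ hc hrel'
    obtain ⟨k, hk⟩ := exists_coe_eq_weyl_mul_lower σ hJ hy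
    have hv : Valued.v (((g : GL (Fin 2) K) : Matrix (Fin 2) (Fin 2) K) 0 0) / Valued.v (((g : GL (Fin 2) K) : Matrix (Fin 2) (Fin 2) K) 1 0) ≤ 1 := div_le_one_of_le₀ hlt.le zero_le
    refine ⟨k, mem_glInt_of_coe_eq σ hJ hσv hk fun i j => ?_, k⁻¹ * g, by group, ?_⟩
    · fin_cases i <;> fin_cases j <;> simp [hv]
    · rw [coe_mul_apply, Subgroup.coe_inv, inv_apply_of_mem σ hJ k, inv_apply_of_mem σ hJ k, hk]
      simp only [show Fin.rev (0 : Fin 2) = 1 from rfl, show Fin.rev (1 : Fin 2) = 0 from rfl]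
      simp [map_div₀]
      have hσc : σ (((g : GL (Fin 2) K) : Matrix (Fin 2) (Fin 2) K) 1 0) ≠ 0 := (map_ne_zero σ).2 hc
      field_simp
      linear_combination hrel'

include hJ in
/-- **Upper triangular, corner dominated by the FIRST diagonal entry**: `b = (p q; 0 s) ∈ U` with `|q| ≤ |p|` is `t · u` with `t = d(p, s)`
and `u = t⁻¹ b = u(q∕p) ∈ K₀`. [cite: BruhatTits1972, (4.4.3)] -/
theorem exists_diag_mul_glInt_of_upper (hσσ : ∀ x, σ (σ x) = x) (hσv : ∀ x, Valued.v (σ x) = Valued.v x)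
    (b : ↥(unitaryGroupOfForm σ J)) (hb : ((b : GL (Fin 2) K) : Matrix (Fin 2) (Fin 2) K) 1 0 = 0) (hqp : Valued.v (((b : GL (Fin 2) K) : Matrix (Fin 2) (Fin 2) K) 0 1) ≤ Valued.v (((b : GL (Fin 2) K) : Matrix (Fin 2) (Fin 2) K) 0 0)) :
    ∃ t : ↥(unitaryGroupOfForm σ J), ∃ u ∈ (glInt 2 K).comap (unitaryGroupOfForm σ J).subtype,
      b = t * u ∧ ((t : GL (Fin 2) K) : Matrix (Fin 2) (Fin 2) K) = !![((b : GL (Fin 2) K) : Matrix (Fin 2) (Fin 2) K) 0 0, 0; 0, ((b : GL (Fin 2) K) : Matrix (Fin 2) (Fin 2) K) 1 1] := by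
  have h01 := rel01 σ hJ b
  have h10 := rel10 σ hJ b
  rw [hb, map_zero, zero_mul, add_zero] at h01
  rw [hb, mul_zero, zero_add] at h10
  obtain ⟨t, ht⟩ := exists_coe_eq_diag σ hJ hσσ h01
  have hp : ((b : GL (Fin 2) K) : Matrix (Fin 2) (Fin 2) K) 0 0 ≠ 0 := fun h => by rw [h, mul_zero] at h10; exact zero_ne_one h10
  have hσs : σ (((b : GL (Fin 2) K) : Matrix (Fin 2) (Fin 2) K) 1 1) = (((b : GL (Fin 2) K) : Matrix (Fin 2) (Fin 2) K) 0 0)⁻¹ := eq_inv_of_mul_eq_one_left h10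
  have hu : (((t⁻¹ * b : ↥(unitaryGroupOfForm σ J)) : GL (Fin 2) K) : Matrix (Fin 2) (Fin 2) K) = !![1, (((b : GL (Fin 2) K) : Matrix (Fin 2) (Fin 2) K) 0 0)⁻¹ * ((b : GL (Fin 2) K) : Matrix (Fin 2) (Fin 2) K) 0 1; 0, 1] := by
    ext i j
    rw [coe_mul_apply, Subgroup.coe_inv, inv_apply_of_mem σ hJ t, inv_apply_of_mem σ hJ t, ht]
    simp only [show Fin.rev (0 : Fin 2) = 1 from rfl, show Fin.rev (1 : Fin 2) = 0 from rfl]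
    fin_cases i <;> fin_cases j <;> simp [hb, h01, hσs, inv_mul_cancel₀ hp]
  refine ⟨t, t⁻¹ * b, mem_glInt_of_coe_eq σ hJ hσv hu fun i j => ?_, by group, ht⟩
  have hv : (Valued.v (((b : GL (Fin 2) K) : Matrix (Fin 2) (Fin 2) K) 0 0))⁻¹ * Valued.v (((b : GL (Fin 2) K) : Matrix (Fin 2) (Fin 2) K) 0 1) ≤ 1 := by
    rw [← div_eq_inv_mul]; exact div_le_one_of_le₀ hqp zero_le
  fin_cases i <;> fin_cases j <;> simp [hv]

include hJ in
/-- **Upper triangular, corner dominated by the SECOND diagonal entry**: `b = (p q; 0 s) ∈ U` with `|q| ≤ |s|` is `u · t` with `t = d(p, s)`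
and `u = b t⁻¹ = u(q∕s) ∈ K₀`. [cite: BruhatTits1972, (4.4.3)] -/
theorem exists_glInt_mul_diag_of_upper (hσσ : ∀ x, σ (σ x) = x) (hσv : ∀ x, Valued.v (σ x) = Valued.v x)
    (b : ↥(unitaryGroupOfForm σ J)) (hb : ((b : GL (Fin 2) K) : Matrix (Fin 2) (Fin 2) K) 1 0 = 0) (hqs : Valued.v (((b : GL (Fin 2) K) : Matrix (Fin 2) (Fin 2) K) 0 1) ≤ Valued.v (((b : GL (Fin 2) K) : Matrix (Fin 2) (Fin 2) K) 1 1)) :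
    ∃ u ∈ (glInt 2 K).comap (unitaryGroupOfForm σ J).subtype, ∃ t : ↥(unitaryGroupOfForm σ J),
      b = u * t ∧ ((t : GL (Fin 2) K) : Matrix (Fin 2) (Fin 2) K) = !![((b : GL (Fin 2) K) : Matrix (Fin 2) (Fin 2) K) 0 0, 0; 0, ((b : GL (Fin 2) K) : Matrix (Fin 2) (Fin 2) K) 1 1] := by
  have h01 := rel01 σ hJ b
  have h10 := rel10 σ hJ b
  rw [hb, map_zero, zero_mul, add_zero] at h01
  rw [hb, mul_zero, zero_add] at h10
  obtain ⟨t, ht⟩ := exists_coe_eq_diag σ hJ hσσ h01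
  have hs : ((b : GL (Fin 2) K) : Matrix (Fin 2) (Fin 2) K) 1 1 ≠ 0 := fun h => by rw [h, mul_zero] at h01; exact zero_ne_one h01
  have hσp : σ (((b : GL (Fin 2) K) : Matrix (Fin 2) (Fin 2) K) 0 0) = (((b : GL (Fin 2) K) : Matrix (Fin 2) (Fin 2) K) 1 1)⁻¹ := eq_inv_of_mul_eq_one_left h01
  have hu : (((b * t⁻¹ : ↥(unitaryGroupOfForm σ J)) : GL (Fin 2) K) : Matrix (Fin 2) (Fin 2) K) = !![1, ((b : GL (Fin 2) K) : Matrix (Fin 2) (Fin 2) K) 0 1 * (((b : GL (Fin 2) K) : Matrix (Fin 2) (Fin 2) K) 1 1)⁻¹; 0, 1] := by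
    ext i j
    rw [coe_mul_apply, Subgroup.coe_inv, inv_apply_of_mem σ hJ t, inv_apply_of_mem σ hJ t, ht]
    simp only [show Fin.rev (0 : Fin 2) = 1 from rfl, show Fin.rev (1 : Fin 2) = 0 from rfl]
    fin_cases i <;> fin_cases j <;> simp [hb, hσp]
    · rw [mul_comm]; exact h10
    · field_simp
  refine ⟨b * t⁻¹, mem_glInt_of_coe_eq σ hJ hσv hu fun i j => ?_, t, by group, ht⟩
  have hv : Valued.v (((b : GL (Fin 2) K) : Matrix (Fin 2) (Fin 2) K) 0 1) * (Valued.v (((b : GL (Fin 2) K) : Matrix (Fin 2) (Fin 2) K) 1 1))⁻¹ ≤ 1 := by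
    rw [← div_eq_mul_inv]; exact div_le_one_of_le₀ hqs zero_le
  fin_cases i <;> fin_cases j <;> simp [hv]

include hJ in
/-- **`B ⊂ K₀ · T · K₀`**: an upper triangular `b = (p q; 0 s) ∈ U(σ, Φ₂)` is `k₁ t k₂` with `k₁, k₂ ∈ K₀` and `t` diagonal — by the two
previous lemmas unless the corner `q` dominates both `p` and `s`, in which case `ū(-s∕q) · b · w₀ = (q p; 0 -sp∕q)` is upper triangular
with dominant first diagonal entry (`|p| < |q|`). [cite: BruhatTits1972, (4.4.3)] [cite: Tits1979, §3.3.2] -/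
theorem exists_glInt_mul_diag_mul_glInt_of_upper (hσσ : ∀ x, σ (σ x) = x) (hσv : ∀ x, Valued.v (σ x) = Valued.v x)
    (b : ↥(unitaryGroupOfForm σ J)) (hb : ((b : GL (Fin 2) K) : Matrix (Fin 2) (Fin 2) K) 1 0 = 0) :
    ∃ k₁ ∈ (glInt 2 K).comap (unitaryGroupOfForm σ J).subtype, ∃ k₂ ∈ (glInt 2 K).comap (unitaryGroupOfForm σ J).subtype, ∃ t : ↥(unitaryGroupOfForm σ J),
      b = k₁ * t * k₂ ∧ ((t : GL (Fin 2) K) : Matrix (Fin 2) (Fin 2) K) 1 0 = 0 ∧ ((t : GL (Fin 2) K) : Matrix (Fin 2) (Fin 2) K) 0 1 = 0 := by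
  rcases le_or_gt (Valued.v (((b : GL (Fin 2) K) : Matrix (Fin 2) (Fin 2) K) 0 1)) (Valued.v (((b : GL (Fin 2) K) : Matrix (Fin 2) (Fin 2) K) 0 0)) with hqp | hpq
  · obtain ⟨t, u, hu, hbe, ht⟩ := exists_diag_mul_glInt_of_upper σ hJ hσσ hσv b hb hqp
    exact ⟨1, Subgroup.one_mem _, u, hu, t, by rw [one_mul]; exact hbe, by rw [ht]; simp, by rw [ht]; simp⟩
  rcases le_or_gt (Valued.v (((b : GL (Fin 2) K) : Matrix (Fin 2) (Fin 2) K) 0 1)) (Valued.v (((b : GL (Fin 2) K) : Matrix (Fin 2) (Fin 2) K) 1 1)) with hqs | hsq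
  · obtain ⟨u, hu, t, hbe, ht⟩ := exists_glInt_mul_diag_of_upper σ hJ hσσ hσv b hb hqs
    exact ⟨u, hu, 1, Subgroup.one_mem _, t, by rw [mul_one]; exact hbe, by rw [ht]; simp, by rw [ht]; simp⟩
  -- the corner dominates: `q ≠ 0`, `y = s/q` is `σ`-skew and small
  have h11 := rel11 σ hJ b
  have hq : ((b : GL (Fin 2) K) : Matrix (Fin 2) (Fin 2) K) 0 1 ≠ 0 := fun h => by rw [h, Valuation.map_zero] at hpq; exact not_lt_zero hpq
  have hy := div_add_map_div_eq_zero σ hq h11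
  have hy' : -(((b : GL (Fin 2) K) : Matrix (Fin 2) (Fin 2) K) 1 1 / ((b : GL (Fin 2) K) : Matrix (Fin 2) (Fin 2) K) 0 1) + σ (-(((b : GL (Fin 2) K) : Matrix (Fin 2) (Fin 2) K) 1 1 / ((b : GL (Fin 2) K) : Matrix (Fin 2) (Fin 2) K) 0 1)) = 0 := by
    rw [map_neg, ← neg_add, hy, neg_zero]
  obtain ⟨k, hk⟩ := exists_coe_eq_lower σ hJ hy'
  obtain ⟨w, hw⟩ := exists_coe_eq_weyl σ hJ
  have hvy : Valued.v (((b : GL (Fin 2) K) : Matrix (Fin 2) (Fin 2) K) 1 1) / Valued.v (((b : GL (Fin 2) K) : Matrix (Fin 2) (Fin 2) K) 0 1) ≤ 1 := div_le_one_of_le₀ hsq.le zero_le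
  have hkK : k ∈ (glInt 2 K).comap (unitaryGroupOfForm σ J).subtype := by
    refine mem_glInt_of_coe_eq σ hJ hσv hk fun i j => ?_
    fin_cases i <;> fin_cases j <;> simp [Valuation.map_neg, hvy]
  have hwK : w ∈ (glInt 2 K).comap (unitaryGroupOfForm σ J).subtype := by
    refine mem_glInt_of_coe_eq σ hJ hσv hw fun i j => ?_
    fin_cases i <;> fin_cases j <;> simp
  -- `b' = k b w = (q p; 0 -sp/q)`
  have hb' : (((k * b * w : ↥(unitaryGroupOfForm σ J)) : GL (Fin 2) K) : Matrix (Fin 2) (Fin 2) K) = !![((b : GL (Fin 2) K) : Matrix (Fin 2) (Fin 2) K) 0 1, ((b : GL (Fin 2) K) : Matrix (Fin 2) (Fin 2) K) 0 0; 0, -(((b : GL (Fin 2) K) : Matrix (Fin 2) (Fin 2) K) 1 1 * ((b : GL (Fin 2) K) : Matrix (Fin 2) (Fin 2) K) 0 0 / ((b : GL (Fin 2) K) : Matrix (Fin 2) (Fin 2) K) 0 1)] := by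
    ext i j
    rw [coe_mul_apply, coe_mul_apply, coe_mul_apply, hk, hw]
    fin_cases i <;> fin_cases j <;> simp [hb]
    · rw [div_mul_cancel₀ _ hq, neg_add_cancel]
    · rw [div_mul_eq_mul_div]
  have hb'10 : (((k * b * w : ↥(unitaryGroupOfForm σ J)) : GL (Fin 2) K) : Matrix (Fin 2) (Fin 2) K) 1 0 = 0 := by rw [hb']; simp
  have hb'le : Valued.v ((((k * b * w : ↥(unitaryGroupOfForm σ J)) : GL (Fin 2) K) : Matrix (Fin 2) (Fin 2) K) 0 1) ≤ Valued.v ((((k * b * w : ↥(unitaryGroupOfForm σ J)) : GL (Fin 2) K) : Matrix (Fin 2) (Fin 2) K) 0 0) := by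
    rw [hb']; simpa using hpq.le
  obtain ⟨t, u, hu, hbe, ht⟩ := exists_diag_mul_glInt_of_upper σ hJ hσσ hσv (k * b * w) hb'10 hb'le
  have hww : w * w = 1 := by
    apply Subtype.ext; apply Units.ext
    change ((w : GL (Fin 2) K) : Matrix (Fin 2) (Fin 2) K) * ((w : GL (Fin 2) K) : Matrix (Fin 2) (Fin 2) K) = 1
    rw [hw]; ext i j; fin_cases i <;> fin_cases j <;> simp
  refine ⟨k⁻¹, Subgroup.inv_mem _ hkK, u * w, Subgroup.mul_mem _ hu hwK, t, ?_, by rw [ht]; simp, by rw [ht]; simp⟩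
  calc b = k⁻¹ * (k * b * w) * w := by rw [show k⁻¹ * (k * b * w) * w = b * (w * w) by group, hww, mul_one]
    _ = k⁻¹ * t * (u * w) := by rw [hbe]; group

end Valuation

/-! ## §3 The ray `a = d(ϖ, (σϖ)⁻¹)`: `T ⊂ K₀ · a^ℕ · K₀`, and the Cartan decomposition -/

section Ray

variable {K : Type*} [Field K] [Valued K ℤᵐ⁰] [ValuativeRel K] [(Valued.v : Valuation K ℤᵐ⁰).Compatible]
  (σ : K →+* K) {J : Matrix (Fin 2) (Fin 2) K} (hJ : J = (StdForm.antidiagonal 2).over K) {ϖ : K}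

omit [Valued K ℤᵐ⁰] [ValuativeRel K] [(Valued.v : Valuation K ℤᵐ⁰).Compatible] in
/-- **Powers of the ray**: `aⁿ` has matrix `d(ϖⁿ, (σϖ)⁻ⁿ)`. [cite: Rogawski1990, §1.10 p. 9] -/
theorem coe_pow_eq_two (a : ↥(unitaryGroupOfForm σ J))
    (ha : ((a : GL (Fin 2) K) : Matrix (Fin 2) (Fin 2) K) = Matrix.diagonal ![ϖ, (σ ϖ)⁻¹]) (n : ℕ) :
    (((a ^ n : ↥(unitaryGroupOfForm σ J)) : GL (Fin 2) K) : Matrix (Fin 2) (Fin 2) K) = !![ϖ ^ n, 0; 0, (σ ϖ)⁻¹ ^ n] := by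
  induction n with
  | zero =>
    rw [pow_zero, Subgroup.coe_one, Units.val_one, pow_zero, pow_zero]
    ext i j; fin_cases i <;> fin_cases j <;> simp
  | succ n ih =>
    rw [pow_succ, Subgroup.coe_mul, Units.val_mul, ih, ha]
    ext i j; fin_cases i <;> fin_cases j <;> simp [pow_succ]

omit [ValuativeRel K] [(Valued.v : Valuation K ℤᵐ⁰).Compatible] in
/-- Every non-zero `x` has `v x = exp(e)` for some `e ∈ ℤ`. [cite: Serre1979, Ch. I §1] -/
private theorem exists_v_eq_exp_two {x : K} (hx : x ≠ 0) : ∃ e : ℤ, Valued.v x = WithZero.exp e :=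
  ⟨_, (WithZero.exp_log ((Valuation.ne_zero_iff _).2 hx)).symm⟩

include hJ in
/-- **A diagonal element whose first entry has the size of `ϖⁿ` lies in `aⁿ · K₀`**: `t = d(γ, (σγ)⁻¹)` with `|γ| = |ϖ|ⁿ` is `aⁿ · d(u, (σu)⁻¹)`,
`u = γ ϖ⁻ⁿ` a unit. [cite: BruhatTits1972, (4.4.3)] [cite: Rogawski1990, §1.10 p. 9] -/
theorem exists_eq_pow_mul_glInt (hσσ : ∀ x, σ (σ x) = x) (hσv : ∀ x, Valued.v (σ x) = Valued.v x) (hϖ0 : ϖ ≠ 0)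
    (a : ↥(unitaryGroupOfForm σ J)) (ha : ((a : GL (Fin 2) K) : Matrix (Fin 2) (Fin 2) K) = Matrix.diagonal ![ϖ, (σ ϖ)⁻¹])
    (t : ↥(unitaryGroupOfForm σ J)) (ht10 : ((t : GL (Fin 2) K) : Matrix (Fin 2) (Fin 2) K) 1 0 = 0) (ht01 : ((t : GL (Fin 2) K) : Matrix (Fin 2) (Fin 2) K) 0 1 = 0) (n : ℕ)
    (hγ : Valued.v (((t : GL (Fin 2) K) : Matrix (Fin 2) (Fin 2) K) 0 0) = Valued.v ϖ ^ n) :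
    ∃ k ∈ (glInt 2 K).comap (unitaryGroupOfForm σ J).subtype, t = a ^ n * k := by
  have hσϖ0 : σ ϖ ≠ 0 := (map_ne_zero σ).2 hϖ0
  have h01 := rel01 σ hJ t
  rw [ht10, map_zero, zero_mul, add_zero] at h01
  have hγ0 : ((t : GL (Fin 2) K) : Matrix (Fin 2) (Fin 2) K) 0 0 ≠ 0 := fun h => by rw [h, map_zero, zero_mul] at h01; exact zero_ne_one h01
  have hδ : ((t : GL (Fin 2) K) : Matrix (Fin 2) (Fin 2) K) 1 1 = (σ (((t : GL (Fin 2) K) : Matrix (Fin 2) (Fin 2) K) 0 0))⁻¹ := eq_inv_of_mul_eq_one_right h01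
  have hk : ((((a ^ n)⁻¹ * t : ↥(unitaryGroupOfForm σ J)) : GL (Fin 2) K) : Matrix (Fin 2) (Fin 2) K) = !![(ϖ ^ n)⁻¹ * ((t : GL (Fin 2) K) : Matrix (Fin 2) (Fin 2) K) 0 0, 0; 0, (σ ϖ) ^ n * ((t : GL (Fin 2) K) : Matrix (Fin 2) (Fin 2) K) 1 1] := by
    ext i j
    rw [coe_mul_apply, Subgroup.coe_inv, inv_apply_of_mem σ hJ (a ^ n), inv_apply_of_mem σ hJ (a ^ n), coe_pow_eq_two σ a ha]
    simp only [show Fin.rev (0 : Fin 2) = 1 from rfl, show Fin.rev (1 : Fin 2) = 0 from rfl]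
    fin_cases i <;> fin_cases j <;> simp [ht10, ht01, map_pow, map_inv₀, hσσ]
  refine ⟨(a ^ n)⁻¹ * t, mem_glInt_of_coe_eq σ hJ hσv hk fun i j => ?_, by group⟩
  have hvϖ0 : Valued.v ϖ ≠ 0 := (Valuation.ne_zero_iff _).2 hϖ0
  have hv0 : (Valued.v ϖ ^ n)⁻¹ * Valued.v (((t : GL (Fin 2) K) : Matrix (Fin 2) (Fin 2) K) 0 0) ≤ 1 := by
    rw [hγ, inv_mul_cancel₀ (pow_ne_zero _ hvϖ0)]
  have hv1 : Valued.v (σ ϖ) ^ n * Valued.v (((t : GL (Fin 2) K) : Matrix (Fin 2) (Fin 2) K) 1 1) ≤ 1 := by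
    rw [hσv, hδ, map_inv₀, hσv, hγ, mul_inv_cancel₀ (pow_ne_zero _ hvϖ0)]
  fin_cases i <;> fin_cases j <;> simp [hv0, hv1]

include hJ in
/-- **`T ⊂ K₀ · a^ℕ · K₀`** (no central correction is needed in two variables): a diagonal `t = d(γ, (σγ)⁻¹)` with `|γ| = |ϖ|ⁿ ≤ 1` is
`aⁿ k` (previous lemma); if `|γ| > 1` then `w₀ t w₀ = d((σγ)⁻¹, γ)` has first entry of size `|ϖ|ⁿ`, so `t = w₀ · aⁿ · (k w₀)`.
[cite: BruhatTits1972, (4.4.3)] [cite: Rogawski1990, §1.10 p. 9] -/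
theorem exists_diag_eq_glInt_mul_pow_mul_glInt (hσσ : ∀ x, σ (σ x) = x) (hσv : ∀ x, Valued.v (σ x) = Valued.v x)
    (hϖ : Valued.v ϖ = WithZero.exp (-1 : ℤ))
    (a : ↥(unitaryGroupOfForm σ J)) (ha : ((a : GL (Fin 2) K) : Matrix (Fin 2) (Fin 2) K) = Matrix.diagonal ![ϖ, (σ ϖ)⁻¹])
    (t : ↥(unitaryGroupOfForm σ J)) (ht10 : ((t : GL (Fin 2) K) : Matrix (Fin 2) (Fin 2) K) 1 0 = 0) (ht01 : ((t : GL (Fin 2) K) : Matrix (Fin 2) (Fin 2) K) 0 1 = 0) :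
    ∃ k₁ ∈ (glInt 2 K).comap (unitaryGroupOfForm σ J).subtype, ∃ k₂ ∈ (glInt 2 K).comap (unitaryGroupOfForm σ J).subtype, ∃ n : ℕ, t = k₁ * a ^ n * k₂ := by
  have hϖ0 : ϖ ≠ 0 := fun h => by rw [h, map_zero] at hϖ; exact WithZero.zero_ne_coe hϖ
  have h01 := rel01 σ hJ t
  rw [ht10, map_zero, zero_mul, add_zero] at h01
  have hγ0 : ((t : GL (Fin 2) K) : Matrix (Fin 2) (Fin 2) K) 0 0 ≠ 0 := fun h => by rw [h, map_zero, zero_mul] at h01; exact zero_ne_one h01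
  have hδ : ((t : GL (Fin 2) K) : Matrix (Fin 2) (Fin 2) K) 1 1 = (σ (((t : GL (Fin 2) K) : Matrix (Fin 2) (Fin 2) K) 0 0))⁻¹ := eq_inv_of_mul_eq_one_right h01
  obtain ⟨e, he⟩ := exists_v_eq_exp_two hγ0
  rcases le_or_gt e 0 with he0 | he0
  · -- `|γ| = |ϖ|^p ≤ 1`
    obtain ⟨p, hp⟩ := Int.exists_eq_neg_ofNat he0
    have hγ : Valued.v (((t : GL (Fin 2) K) : Matrix (Fin 2) (Fin 2) K) 0 0) = Valued.v ϖ ^ p := by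
      rw [he, hp, hϖ, ← zpow_natCast, ← WithZero.exp_zsmul, smul_eq_mul, mul_neg, mul_one]
    obtain ⟨k, hk, hte⟩ := exists_eq_pow_mul_glInt σ hJ hσσ hσv hϖ0 a ha t ht10 ht01 p hγ
    exact ⟨1, Subgroup.one_mem _, k, hk, p, by rw [one_mul]; exact hte⟩
  · -- `|γ| > 1`: conjugate by `w₀`
    obtain ⟨p, hp⟩ := Int.eq_ofNat_of_zero_le he0.le
    obtain ⟨w, hw⟩ := exists_coe_eq_weyl σ hJ
    have hwK : w ∈ (glInt 2 K).comap (unitaryGroupOfForm σ J).subtype := by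
      refine mem_glInt_of_coe_eq σ hJ hσv hw fun i j => ?_
      fin_cases i <;> fin_cases j <;> simp
    have hww : w * w = 1 := by
      apply Subtype.ext; apply Units.ext
      change ((w : GL (Fin 2) K) : Matrix (Fin 2) (Fin 2) K) * ((w : GL (Fin 2) K) : Matrix (Fin 2) (Fin 2) K) = 1
      rw [hw]; ext i j; fin_cases i <;> fin_cases j <;> simp
    have ht' : (((w * t * w : ↥(unitaryGroupOfForm σ J)) : GL (Fin 2) K) : Matrix (Fin 2) (Fin 2) K) = !![((t : GL (Fin 2) K) : Matrix (Fin 2) (Fin 2) K) 1 1, 0; 0, ((t : GL (Fin 2) K) : Matrix (Fin 2) (Fin 2) K) 0 0] := by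
      ext i j
      rw [coe_mul_apply, coe_mul_apply, coe_mul_apply, hw]
      fin_cases i <;> fin_cases j <;> simp [ht10, ht01]
    have ht'10 : (((w * t * w : ↥(unitaryGroupOfForm σ J)) : GL (Fin 2) K) : Matrix (Fin 2) (Fin 2) K) 1 0 = 0 := by rw [ht']; simp
    have ht'01 : (((w * t * w : ↥(unitaryGroupOfForm σ J)) : GL (Fin 2) K) : Matrix (Fin 2) (Fin 2) K) 0 1 = 0 := by rw [ht']; simp
    have hγ' : Valued.v ((((w * t * w : ↥(unitaryGroupOfForm σ J)) : GL (Fin 2) K) : Matrix (Fin 2) (Fin 2) K) 0 0) = Valued.v ϖ ^ p := by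
      rw [ht']
      simp only [Matrix.of_apply, Matrix.cons_val', Matrix.cons_val_zero, Matrix.cons_val_fin_one]
      rw [hδ, map_inv₀, hσv, he, hp, hϖ, ← zpow_natCast, ← WithZero.exp_zsmul, smul_eq_mul, mul_neg, mul_one,
        ← WithZero.exp_neg]
    obtain ⟨k, hk, hte⟩ := exists_eq_pow_mul_glInt σ hJ hσσ hσv hϖ0 a ha (w * t * w) ht'10 ht'01 p hγ'
    refine ⟨w, hwK, k * w, Subgroup.mul_mem _ hk hwK, p, ?_⟩
    calc t = w * (w * t * w) * w := by rw [show w * (w * t * w) * w = (w * w) * t * (w * w) by group, hww, one_mul, mul_one]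
      _ = w * a ^ p * (k * w) := by rw [hte]; group

include hJ in
/-- **THE CARTAN DECOMPOSITION OF THE QUASI-SPLIT UNITARY GROUP IN TWO VARIABLES FOR ANY ISOMETRIC INVOLUTION** — ramified quadratic
`K ∕ K^σ` and residue characteristic `2` INCLUDED.  For `σ` an involution of `K` preserving the valuation, `ϖ` ANY uniformiser of `K` and
`a = d(ϖ, (σϖ)⁻¹) ∈ U = U(σ, Φ₂)(K)`: every `g ∈ U` is `k₁ aⁿ k₂ z` with `k₁, k₂ ∈ K₀ = U ∩ GL₂(𝒪)`, `n ≥ 0`, `z` central (here `z = 1`) —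
EXACTLY the hypothesis `hCartan₂` of ★ `jacquetVanishing_isSupercuspidal_two_of_cartan`.  Proof: row reduction `g = k b` (§2), `b = k₁ t k₂`
(§2), `t = k₃ aⁿ k₄` (§3). [cite: BruhatTits1972, (4.4.3)] [cite: Tits1979, §3.3.3] [cite: Rogawski1990, §1.10 p. 9] -/
theorem exists_cartan_of_involution_two (hσσ : ∀ x, σ (σ x) = x) (hσv : ∀ x, Valued.v (σ x) = Valued.v x)
    (hϖ : Valued.v ϖ = WithZero.exp (-1 : ℤ))
    (a : ↥(unitaryGroupOfForm σ J)) (ha : ((a : GL (Fin 2) K) : Matrix (Fin 2) (Fin 2) K) = Matrix.diagonal ![ϖ, (σ ϖ)⁻¹])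
    (g : ↥(unitaryGroupOfForm σ J)) :
    ∃ k₁ ∈ (glInt 2 K).comap (unitaryGroupOfForm σ J).subtype, ∃ k₂ ∈ (glInt 2 K).comap (unitaryGroupOfForm σ J).subtype,
      ∃ n : ℕ, ∃ z ∈ Subgroup.center ↥(unitaryGroupOfForm σ J), g = k₁ * a ^ n * k₂ * z := by
  obtain ⟨k, hk, b, hgb, hb⟩ := exists_glInt_mul_upper σ hJ hσv g
  obtain ⟨k₁, hk₁, k₂, hk₂, t, hbt, ht10, ht01⟩ := exists_glInt_mul_diag_mul_glInt_of_upper σ hJ hσσ hσv b hb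
  obtain ⟨k₃, hk₃, k₄, hk₄, n, hte⟩ := exists_diag_eq_glInt_mul_pow_mul_glInt σ hJ hσσ hσv hϖ a ha t ht10 ht01
  refine ⟨k * k₁ * k₃, Subgroup.mul_mem _ (Subgroup.mul_mem _ hk hk₁) hk₃, k₄ * k₂, Subgroup.mul_mem _ hk₄ hk₂, n, 1,
    Subgroup.one_mem _, ?_⟩
  rw [hgb, hbt, hte]; group

end Ray

end Two

end UnitaryGroup

end Literature.NumberTheory.Automorphic
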